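/-
Copyright (c) 2026 the pub-hodgecm-mathlib formalisation cell (harness21).  Prover seat hodgecm-mathlib-K2E3-p25 (g5), Track B «K2-LIT»,
hLiu418 = `stmt-HodgeConjecture-24832`; K1a desk K2Liu-p01 (g11) WORDS #36∕#38 «(C-K-1a)»: the Lie-ray velocities of the point data.
THEOREMS ONLY (no `def`, no instance, no notation, no named-fact hypothesis, no `sorry`); lane `--supports stmt-HodgeConjecture-24832 --as helper`.
-/
import Summits.HodgeConjecture.HodgeConjecture.Theorems.K2LiuArchScalarSectionCurveDerivative   -- ★ Jacobi along a right curve, `hasDerivAt_exp_smul_entry`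
import Summits.HodgeConjecture.HodgeConjecture.Theorems.K2LiuArchPointRayCalculus               -- ★ FILE 1: differentiability of the point data, `det d ≠ 0` on the ray
import Summits.HodgeConjecture.HodgeConjecture.Theorems.K2LiuArchSiegelHalfSpaceHeightBounds      -- ★ (m2): `V = d⁻ᴴd⁻¹`, entries of `d, d⁻¹, num` vs `R`
import Summits.HodgeConjecture.HodgeConjecture.Theorems.K2LiuHermTwoGammaDefs                    -- ★ `hermTwo`
import HarnessLib

/-!
# Crux `HLiu418`, (Φ-S1) road B, (C-K-1a): VELOCITIES OF THE POINT DATA ALONG A LIE RAY `τ ↦ g·exp(τX)`, WITH MAJORANTS POLYNOMIAL IN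
# `(R, ‖X‖)` AND — FOR THE WEIGHT COORDINATE `P` AND THE CHARACTER'S PHASE — LINEAR IN `P`, UNIFORMLY IN THE DATUM `a`

Cell `hodgecm-mathlib`, crux item hLiu418 = `stmt-HodgeConjecture-24832` (helper lane, count-neutral).  Input of (C-K-1c) (growth of the first
non-scalar rung letter `d/dτ|₀ Ac s (g·exp(τX))`): ★ p864004's explicit letter sees the point `h` only through `δ = det d` (`d = denom(h, i1)`), `‖δ‖`,
the phase `u = tr(T·Re(h·i1))` (`T = a·diag(t,0)·aᴴ`) and the weight `aᴴ(2V)a` (`V = Im(h·i1) = d⁻ᴴd⁻¹`, ★ `im_moeb_I_eq`).  Along `g·exp(τX)`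
(`g ∈ U(J)` entries `≤ R`, `X ∈ 𝔲(J)` entries `≤ RX`) at `τ = 0`: §1 `denom`∕`num` have velocity the same letter at `g·X`; `δ′ = δ·tr(d⁻¹·denom(gX,i1))`
(★ Jacobi), `‖δ‖′ = ‖δ‖·Re tr(…)`, `|tr(…)| ≤ 128R²·RX`; §2 `(d⁻¹)′ = −d⁻¹d′d⁻¹`, `moeb′ = (num(gX) − moeb·d′)d⁻¹`; §3 `(aᴴ(2V)a)₀₀ = 2Σ‖(d⁻¹a)ᵢ₀‖²`
for ANY `a`, so `P′ = 4Re⟨v, v′⟩`, `v = d⁻¹(ae₀)`, `v′ = −d⁻¹d′v`, **`|P′| ≤ 256R²·RX·P`**; §4 `tr(T·N) = t·(ae₀)ᴴN(ae₀)`, `(ae₀)ᴴmoeb′(ae₀) =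
vᴴdᴴ(num(gX) − moeb·d′)v`, **`|u′| ≤ 1056(1+R)⁴·RX·(tP)`** — the constants never see `a`.  With ★ ParamSmooth (d) these are all the `τ`-derivatives
the product rule of ★ FILE 2b produces.

HONEST LABEL: calculus of the point data, closes no socket; HC_CM is proved only modulo the 7 printed citations (2 remaining named inputs:
hLiu418 = `stmt-HodgeConjecture-24832`, h413 = `stmt-HodgeConjecture-24833`) until rung 0 closes.  REL ≠ ★ ≠ BUILT.

## References
* [Knapp1986] A. W. Knapp, *Representation Theory of Semisimple Groups*, Princeton (1986), Ch. I §1, Ch. VIII §3.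
* [Shimura1997] G. Shimura, *Euler Products and Eisenstein Series*, CBMS 93 (1997), §5.6, §6.3, §16.4.
-/

set_option autoImplicit false
set_option linter.dupNamespace false

noncomputable section

open Complex Matrix NormedSpace
open scoped ComplexConjugate ComplexOrder InnerProductSpace

namespace Summit.HodgeConjecture.HodgeConjecture.Cruxes.HLiu418.K2LiuArchTwistedRayAtomBounds

open Literature.NumberTheory.ModularForms.SiegelUpperHalfSpace (num denom moeb num_def denom_def moeb_def moeb_mul_denom)
open Summit.HodgeConjecture.HodgeConjecture.Cruxes.HLiu418.K2LiuHermTwoGammaDefs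
open Summit.HodgeConjecture.HodgeConjecture.Cruxes.HLiu418.K2LiuHermitianTubeCocycle (mul_mem_UJ isUnit_det_denom posDef_im_I_smul_one)
open Summit.HodgeConjecture.HodgeConjecture.Cruxes.HLiu418.K2LiuLieRayDifferentiability (conjTranspose_exp_mul_J_mul_exp)
open Summit.HodgeConjecture.HodgeConjecture.Cruxes.HLiu418.K2LiuArchBlockHeightBound (norm_mul_apply_le)
open Summit.HodgeConjecture.HodgeConjecture.Cruxes.HLiu418.K2LiuArchSiegelHalfSpaceHeightBounds (norm_denom_I_apply_le norm_num_I_apply_le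
  norm_inv_denom_I_apply_le im_moeb_I_eq norm_star_dotProduct_le norm_mulVec_apply_le star_dotProduct_self_eq)
open Summit.HodgeConjecture.HodgeConjecture.Cruxes.HLiu418.K2LiuArchScalarSectionCurveDerivative (hasDerivAt_det_denom_mul_curve
  hasDerivAt_exp_smul_entry exp_zero_smul_eq_one)
open Summit.HodgeConjecture.HodgeConjecture.Cruxes.HLiu418.K2LiuArchPointRayCalculus (det_denom_mul_exp_ne_zero differentiable_inv_denom_entry)

/-! ## §1 The linear data along the ray, the determinant and its norm -/

/-- The entries of the ray `τ ↦ g·exp(τX)` have velocity `g·X` at `τ = 0`. [Knapp1986, Ch. I §1] -/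
theorem hasDerivAt_mul_exp_entry (g X : Matrix (Fin 2 ⊕ Fin 2) (Fin 2 ⊕ Fin 2) ℂ) (p q : Fin 2 ⊕ Fin 2) :
    HasDerivAt (fun τ : ℝ => (g * NormedSpace.exp (τ • X)) p q) ((g * X) p q) 0 := by
  rw [show (fun τ : ℝ => (g * NormedSpace.exp (τ • X)) p q) = fun τ => ∑ m, g p m * NormedSpace.exp (τ • X) m q from
    funext fun τ => Matrix.mul_apply, Matrix.mul_apply]
  exact HasDerivAt.fun_sum fun m _ => (hasDerivAt_exp_smul_entry X m q).const_mul (g p m)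

/-- The entries of `denom(g·exp(τX), i1)` have velocity `denom(g·X, i1)` at `τ = 0` (`denom(·, i1) = i·(·)₂₁ + (·)₂₂` is linear). [Shimura1997, §5.6] -/
theorem hasDerivAt_denom_entry_ray (g X : Matrix (Fin 2 ⊕ Fin 2) (Fin 2 ⊕ Fin 2) ℂ) (i j : Fin 2) :
    HasDerivAt (fun τ : ℝ => denom (g * NormedSpace.exp (τ • X)) (I • (1 : Matrix (Fin 2) (Fin 2) ℂ)) i j)
      (denom (g * X) (I • (1 : Matrix (Fin 2) (Fin 2) ℂ)) i j) 0 := by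
  have h : ∀ P : Matrix (Fin 2 ⊕ Fin 2) (Fin 2 ⊕ Fin 2) ℂ, denom P (I • (1 : Matrix (Fin 2) (Fin 2) ℂ)) i j =
      I * P (Sum.inr i) (Sum.inl j) + P (Sum.inr i) (Sum.inr j) := fun P => by
    rw [denom_def, Matrix.mul_smul, Matrix.mul_one]
    simp [Matrix.toBlocks₂₁, Matrix.toBlocks₂₂]
  simp_rw [h]
  exact ((hasDerivAt_mul_exp_entry g X _ _).const_mul I).add (hasDerivAt_mul_exp_entry g X _ _)

/-- The entries of `num(g·exp(τX), i1)` have velocity `num(g·X, i1)` at `τ = 0`. [Shimura1997, §5.6] -/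
theorem hasDerivAt_num_entry_ray (g X : Matrix (Fin 2 ⊕ Fin 2) (Fin 2 ⊕ Fin 2) ℂ) (i j : Fin 2) :
    HasDerivAt (fun τ : ℝ => num (g * NormedSpace.exp (τ • X)) (I • (1 : Matrix (Fin 2) (Fin 2) ℂ)) i j)
      (num (g * X) (I • (1 : Matrix (Fin 2) (Fin 2) ℂ)) i j) 0 := by
  have h : ∀ P : Matrix (Fin 2 ⊕ Fin 2) (Fin 2 ⊕ Fin 2) ℂ, num P (I • (1 : Matrix (Fin 2) (Fin 2) ℂ)) i j =
      I * P (Sum.inl i) (Sum.inl j) + P (Sum.inl i) (Sum.inr j) := fun P => by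
    rw [num_def, Matrix.mul_smul, Matrix.mul_one]
    simp [Matrix.toBlocks₁₁, Matrix.toBlocks₁₂]
  simp_rw [h]
  exact ((hasDerivAt_mul_exp_entry g X _ _).const_mul I).add (hasDerivAt_mul_exp_entry g X _ _)

/-- **`δ′ = δ·tr(d⁻¹·denom(gX, i1))`**: the velocity of `det denom(g·exp(τX), i1)` at `τ = 0` (★ Jacobi along a right curve, `det d ≠ 0` on `U(J)`).
[Shimura1997, §5.6] -/
theorem hasDerivAt_det_denom_ray {g : Matrix (Fin 2 ⊕ Fin 2) (Fin 2 ⊕ Fin 2) ℂ} (hg : gᴴ * Matrix.J (Fin 2) ℂ * g = Matrix.J (Fin 2) ℂ)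
    (X : Matrix (Fin 2 ⊕ Fin 2) (Fin 2 ⊕ Fin 2) ℂ) :
    HasDerivAt (fun τ : ℝ => (denom (g * NormedSpace.exp (τ • X)) (I • (1 : Matrix (Fin 2) (Fin 2) ℂ))).det)
      ((denom g (I • (1 : Matrix (Fin 2) (Fin 2) ℂ))).det *
        ((denom g (I • (1 : Matrix (Fin 2) (Fin 2) ℂ)))⁻¹ * denom (g * X) (I • (1 : Matrix (Fin 2) (Fin 2) ℂ))).trace) 0 :=
  hasDerivAt_det_denom_mul_curve (isUnit_det_denom hg posDef_im_I_smul_one).ne_zero (γ := fun τ : ℝ => NormedSpace.exp (τ • X))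
    (exp_zero_smul_eq_one X) (hasDerivAt_exp_smul_entry X)

/-- **`‖δ‖′ = ‖δ‖·Re tr(d⁻¹·denom(gX, i1))`**: the velocity of `‖det denom(g·exp(τX), i1)‖` at `τ = 0`. [Shimura1997, §5.6, §16.4] -/
theorem hasDerivAt_norm_det_denom_ray {g : Matrix (Fin 2 ⊕ Fin 2) (Fin 2 ⊕ Fin 2) ℂ} (hg : gᴴ * Matrix.J (Fin 2) ℂ * g = Matrix.J (Fin 2) ℂ)
    (X : Matrix (Fin 2 ⊕ Fin 2) (Fin 2 ⊕ Fin 2) ℂ) :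
    HasDerivAt (fun τ : ℝ => ‖(denom (g * NormedSpace.exp (τ • X)) (I • (1 : Matrix (Fin 2) (Fin 2) ℂ))).det‖)
      (‖(denom g (I • (1 : Matrix (Fin 2) (Fin 2) ℂ))).det‖ *
        ((denom g (I • (1 : Matrix (Fin 2) (Fin 2) ℂ)))⁻¹ * denom (g * X) (I • (1 : Matrix (Fin 2) (Fin 2) ℂ))).trace.re) 0 := by
  set Δ : Matrix (Fin 2) (Fin 2) ℂ := denom g (I • (1 : Matrix (Fin 2) (Fin 2) ℂ)) with hΔ
  set tr : ℂ := (Δ⁻¹ * denom (g * X) (I • (1 : Matrix (Fin 2) (Fin 2) ℂ))).trace with htr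
  set δ : ℝ → ℂ := fun τ => (denom (g * NormedSpace.exp (τ • X)) (I • (1 : Matrix (Fin 2) (Fin 2) ℂ))).det with hδdef
  have hδ : HasDerivAt δ (Δ.det * tr) 0 := hasDerivAt_det_denom_ray hg X
  have hδ0 : δ 0 = Δ.det := by simp only [hδdef, zero_smul, NormedSpace.exp_zero, Matrix.mul_one, hΔ]
  have hnpos : 0 < ‖Δ.det‖ := norm_pos_iff.mpr (isUnit_det_denom hg posDef_im_I_smul_one).ne_zero
  have hnsq : HasDerivAt (fun τ : ℝ => ‖δ τ‖ ^ 2) (2 * ⟪δ 0, Δ.det * tr⟫_ℝ) 0 := hδ.norm_sq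
  rw [hδ0, show ⟪Δ.det, Δ.det * tr⟫_ℝ = ‖Δ.det‖ ^ 2 * tr.re by
    rw [Complex.inner, mul_right_comm, Complex.mul_conj, Complex.normSq_eq_norm_sq, Complex.re_ofReal_mul]] at hnsq
  have hsqrt : HasDerivAt (fun τ : ℝ => Real.sqrt (‖δ τ‖ ^ 2)) ((2 * (‖Δ.det‖ ^ 2 * tr.re)) / (2 * Real.sqrt (‖δ 0‖ ^ 2))) 0 :=
    hnsq.sqrt (by rw [hδ0]; positivity)
  have h2 : (fun τ : ℝ => Real.sqrt (‖δ τ‖ ^ 2)) = fun τ => ‖δ τ‖ := funext fun τ => Real.sqrt_sq (norm_nonneg _)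
  rw [h2, hδ0, Real.sqrt_sq (norm_nonneg _)] at hsqrt
  convert hsqrt using 1
  field_simp

/-- The entries of `g·X` are `≤ 4·R·RX`. [folklore] -/
theorem norm_mul_X_apply_le {g X : Matrix (Fin 2 ⊕ Fin 2) (Fin 2 ⊕ Fin 2) ℂ} {R RX : ℝ} (hR : ∀ i j, ‖g i j‖ ≤ R) (hRX : ∀ i j, ‖X i j‖ ≤ RX)
    (p q : Fin 2 ⊕ Fin 2) : ‖(g * X) p q‖ ≤ 4 * R * RX := by
  have hR0 : 0 ≤ R := (norm_nonneg _).trans (hR p q)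
  have h := norm_mul_apply_le hR0 hR hRX p q
  simp only [Fintype.card_sum, Fintype.card_fin] at h
  push_cast at h
  linarith

/-- **`|tr(d⁻¹·denom(gX, i1))| ≤ 128·R²·RX`** (entries of `d⁻¹` are `≤ 4R` by ★ (m2), of `denom(gX, i1)` are `≤ 8·R·RX`). [Shimura1997, §6.3] -/
theorem norm_trace_inv_denom_mul_le {g X : Matrix (Fin 2 ⊕ Fin 2) (Fin 2 ⊕ Fin 2) ℂ} (hg : gᴴ * Matrix.J (Fin 2) ℂ * g = Matrix.J (Fin 2) ℂ)
    {R RX : ℝ} (hR : ∀ i j, ‖g i j‖ ≤ R) (hRX : ∀ i j, ‖X i j‖ ≤ RX) :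
    ‖((denom g (I • (1 : Matrix (Fin 2) (Fin 2) ℂ)))⁻¹ * denom (g * X) (I • (1 : Matrix (Fin 2) (Fin 2) ℂ))).trace‖ ≤ 128 * R ^ 2 * RX := by
  have hR0 : 0 ≤ R := (norm_nonneg _).trans (hR (Sum.inl 0) (Sum.inl 0))
  have hinv : ∀ i j, ‖(denom g (I • (1 : Matrix (Fin 2) (Fin 2) ℂ)))⁻¹ i j‖ ≤ 4 * R := fun i j => by
    have h := norm_inv_denom_I_apply_le hg hR i j
    simp only [Fintype.card_fin, Nat.cast_ofNat] at h
    linarith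
  have hd' : ∀ i j, ‖denom (g * X) (I • (1 : Matrix (Fin 2) (Fin 2) ℂ)) i j‖ ≤ 2 * (4 * R * RX) :=
    norm_denom_I_apply_le (norm_mul_X_apply_le hR hRX)
  have hprod : ∀ i j, ‖((denom g (I • (1 : Matrix (Fin 2) (Fin 2) ℂ)))⁻¹ * denom (g * X) (I • (1 : Matrix (Fin 2) (Fin 2) ℂ))) i j‖ ≤
      2 * ((4 * R) * (2 * (4 * R * RX))) := fun i j => by
    have h := norm_mul_apply_le (by positivity) hinv hd' i j
    simp only [Fintype.card_fin, Nat.cast_ofNat] at h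
    exact h
  rw [Matrix.trace_fin_two]
  calc _ ≤ ‖((denom g (I • (1 : Matrix (Fin 2) (Fin 2) ℂ)))⁻¹ * denom (g * X) (I • (1 : Matrix (Fin 2) (Fin 2) ℂ))) 0 0‖ +
        ‖((denom g (I • (1 : Matrix (Fin 2) (Fin 2) ℂ)))⁻¹ * denom (g * X) (I • (1 : Matrix (Fin 2) (Fin 2) ℂ))) 1 1‖ := norm_add_le _ _
    _ ≤ 2 * ((4 * R) * (2 * (4 * R * RX))) + 2 * ((4 * R) * (2 * (4 * R * RX))) := add_le_add (hprod 0 0) (hprod 1 1)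
    _ = 128 * R ^ 2 * RX := by ring

/-! ## §2 The inverse denominator and the Möbius point along the ray -/

/-- **`(d⁻¹)′ = −d⁻¹·d′·d⁻¹`** entrywise at `τ = 0` (`d(τ) = denom(g·exp(τX), i1)`, `d′ = denom(gX, i1)`): differentiate `d(τ)⁻¹·d(τ) = 1`
(invertible all along the ray, ★ FILE 1) and solve. [Shimura1997, §5.6] -/
theorem hasDerivAt_inv_denom_entry_ray {g X : Matrix (Fin 2 ⊕ Fin 2) (Fin 2 ⊕ Fin 2) ℂ} (hg : gᴴ * Matrix.J (Fin 2) ℂ * g = Matrix.J (Fin 2) ℂ)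
    (hX : Xᴴ * Matrix.J (Fin 2) ℂ + Matrix.J (Fin 2) ℂ * X = 0) (i j : Fin 2) :
    HasDerivAt (fun τ : ℝ => (denom (g * NormedSpace.exp (τ • X)) (I • (1 : Matrix (Fin 2) (Fin 2) ℂ)))⁻¹ i j)
      ((-((denom g (I • (1 : Matrix (Fin 2) (Fin 2) ℂ)))⁻¹ * denom (g * X) (I • (1 : Matrix (Fin 2) (Fin 2) ℂ)) *
        (denom g (I • (1 : Matrix (Fin 2) (Fin 2) ℂ)))⁻¹)) i j) 0 := by
  set Δ : Matrix (Fin 2) (Fin 2) ℂ := denom g (I • (1 : Matrix (Fin 2) (Fin 2) ℂ)) with hΔ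
  set d' : Matrix (Fin 2) (Fin 2) ℂ := denom (g * X) (I • (1 : Matrix (Fin 2) (Fin 2) ℂ)) with hd'
  set d : ℝ → Matrix (Fin 2) (Fin 2) ℂ := fun τ => denom (g * NormedSpace.exp (τ • X)) (I • (1 : Matrix (Fin 2) (Fin 2) ℂ)) with hddef
  have hd0 : d 0 = Δ := by simp only [hddef, zero_smul, NormedSpace.exp_zero, Matrix.mul_one, hΔ]
  have hΔu : IsUnit Δ.det := isUnit_det_denom hg posDef_im_I_smul_one
  set D : Matrix (Fin 2) (Fin 2) ℂ := Matrix.of fun i j => deriv (fun τ : ℝ => (d τ)⁻¹ i j) 0 with hD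
  have hDij : ∀ i j, HasDerivAt (fun τ : ℝ => (d τ)⁻¹ i j) (D i j) 0 := fun i j =>
    ((differentiable_inv_denom_entry hg hX i j) 0).hasDerivAt
  have hrel : ∀ i j, (D * Δ + Δ⁻¹ * d') i j = 0 := fun i j => by
    have hprod : HasDerivAt (fun τ : ℝ => ∑ k, (d τ)⁻¹ i k * d τ k j) (∑ k, (D i k * Δ k j + Δ⁻¹ i k * d' k j)) 0 := by
      refine HasDerivAt.fun_sum fun k _ => ?_
      have h := (hDij i k).fun_mul (hasDerivAt_denom_entry_ray g X k j)
      rw [hd0, zero_smul, NormedSpace.exp_zero, Matrix.mul_one] at h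
      exact h
    have hconst : HasDerivAt (fun τ : ℝ => ∑ k, (d τ)⁻¹ i k * d τ k j) 0 0 := by
      rw [show (fun τ : ℝ => ∑ k, (d τ)⁻¹ i k * d τ k j) = fun _ => (1 : Matrix (Fin 2) (Fin 2) ℂ) i j from funext fun τ => by
        rw [← Matrix.mul_apply, Matrix.nonsing_inv_mul _ (isUnit_iff_ne_zero.mpr (det_denom_mul_exp_ne_zero hg hX τ))]]
      exact hasDerivAt_const _ _
    rw [Matrix.add_apply, Matrix.mul_apply, Matrix.mul_apply, ← Finset.sum_add_distrib]
    exact hprod.unique hconst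
  have hDeq : D = -(Δ⁻¹ * d' * Δ⁻¹) := by
    calc D = D * Δ * Δ⁻¹ := by rw [Matrix.mul_nonsing_inv_cancel_right _ _ hΔu]
      _ = -(Δ⁻¹ * d' * Δ⁻¹) := by rw [eq_neg_of_add_eq_zero_left (Matrix.ext hrel : D * Δ + Δ⁻¹ * d' = 0), Matrix.neg_mul]
  exact hDeq ▸ hDij i j

/-- **`moeb′ = (num(gX, i1) − moeb·d′)·d⁻¹`** entrywise at `τ = 0`: differentiate `moeb = num·d⁻¹`. [Shimura1997, §5.6, §6.3] -/
theorem hasDerivAt_moeb_entry_ray {g X : Matrix (Fin 2 ⊕ Fin 2) (Fin 2 ⊕ Fin 2) ℂ} (hg : gᴴ * Matrix.J (Fin 2) ℂ * g = Matrix.J (Fin 2) ℂ)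
    (hX : Xᴴ * Matrix.J (Fin 2) ℂ + Matrix.J (Fin 2) ℂ * X = 0) (i j : Fin 2) :
    HasDerivAt (fun τ : ℝ => moeb (g * NormedSpace.exp (τ • X)) (I • (1 : Matrix (Fin 2) (Fin 2) ℂ)) i j)
      (((num (g * X) (I • (1 : Matrix (Fin 2) (Fin 2) ℂ)) - moeb g (I • (1 : Matrix (Fin 2) (Fin 2) ℂ)) * denom (g * X) (I • (1 : Matrix (Fin 2) (Fin 2) ℂ))) *
        (denom g (I • (1 : Matrix (Fin 2) (Fin 2) ℂ)))⁻¹) i j) 0 := by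
  set Δ : Matrix (Fin 2) (Fin 2) ℂ := denom g (I • (1 : Matrix (Fin 2) (Fin 2) ℂ)) with hΔ
  set d' : Matrix (Fin 2) (Fin 2) ℂ := denom (g * X) (I • (1 : Matrix (Fin 2) (Fin 2) ℂ)) with hd'
  set n' : Matrix (Fin 2) (Fin 2) ℂ := num (g * X) (I • (1 : Matrix (Fin 2) (Fin 2) ℂ)) with hn'
  rw [show (fun τ : ℝ => moeb (g * NormedSpace.exp (τ • X)) (I • (1 : Matrix (Fin 2) (Fin 2) ℂ)) i j) =
      fun τ => ∑ q, num (g * NormedSpace.exp (τ • X)) (I • (1 : Matrix (Fin 2) (Fin 2) ℂ)) i q *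
        (denom (g * NormedSpace.exp (τ • X)) (I • (1 : Matrix (Fin 2) (Fin 2) ℂ)))⁻¹ q j from funext fun τ => by rw [moeb_def, Matrix.mul_apply]]
  have hsum : HasDerivAt (fun τ : ℝ => ∑ q, num (g * NormedSpace.exp (τ • X)) (I • (1 : Matrix (Fin 2) (Fin 2) ℂ)) i q *
        (denom (g * NormedSpace.exp (τ • X)) (I • (1 : Matrix (Fin 2) (Fin 2) ℂ)))⁻¹ q j)
      (∑ q, (n' i q * Δ⁻¹ q j + num g (I • (1 : Matrix (Fin 2) (Fin 2) ℂ)) i q * (-(Δ⁻¹ * d' * Δ⁻¹)) q j)) 0 := by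
    refine HasDerivAt.fun_sum fun q _ => ?_
    have h := (hasDerivAt_num_entry_ray g X i q).mul (hasDerivAt_inv_denom_entry_ray hg hX q j)
    rw [zero_smul, NormedSpace.exp_zero, Matrix.mul_one] at h
    exact h
  refine hsum.congr_deriv ?_
  have key : n' * Δ⁻¹ + num g (I • (1 : Matrix (Fin 2) (Fin 2) ℂ)) * (-(Δ⁻¹ * d' * Δ⁻¹)) =
      (n' - moeb g (I • (1 : Matrix (Fin 2) (Fin 2) ℂ)) * d') * Δ⁻¹ := by
    rw [hΔ, moeb_def]
    noncomm_ring
  rw [← key, Matrix.add_apply, Matrix.mul_apply, Matrix.mul_apply, ← Finset.sum_add_distrib]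

/-! ## §3 The weight coordinate `P = (aᴴ(2V)a)₀₀`: the sum-of-squares formula and its velocity, uniformly in `a` -/

/-- **`(aᴴ(2V)a)₀₀ = 2·Σᵢ ‖(d⁻¹a)ᵢ₀‖²`** for `h ∈ U(J)` and ANY `a` (`V = Im(h·i1) = d⁻ᴴd⁻¹`, ★ `im_moeb_I_eq`). [Shimura1997, §6.3] -/
theorem weight_apply_zero_zero_eq {h : Matrix (Fin 2 ⊕ Fin 2) (Fin 2 ⊕ Fin 2) ℂ} (hh : hᴴ * Matrix.J (Fin 2) ℂ * h = Matrix.J (Fin 2) ℂ)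
    (a : Matrix (Fin 2) (Fin 2) ℂ) :
    (aᴴ * ((2 : ℂ) • ((2 * I)⁻¹ • (moeb h (I • (1 : Matrix (Fin 2) (Fin 2) ℂ)) - (moeb h (I • (1 : Matrix (Fin 2) (Fin 2) ℂ)))ᴴ))) * a) 0 0 =
      ((2 * ∑ i, ‖((denom h (I • (1 : Matrix (Fin 2) (Fin 2) ℂ)))⁻¹ * a) i 0‖ ^ 2 : ℝ) : ℂ) := by
  rw [im_moeb_I_eq hh, ← Matrix.conjTranspose_nonsing_inv, Matrix.mul_smul, Matrix.smul_mul, Matrix.smul_apply, smul_eq_mul,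
    show aᴴ * (((denom h (I • (1 : Matrix (Fin 2) (Fin 2) ℂ)))⁻¹)ᴴ * (denom h (I • (1 : Matrix (Fin 2) (Fin 2) ℂ)))⁻¹) * a =
      ((denom h (I • (1 : Matrix (Fin 2) (Fin 2) ℂ)))⁻¹ * a)ᴴ * ((denom h (I • (1 : Matrix (Fin 2) (Fin 2) ℂ)))⁻¹ * a) by
      rw [Matrix.conjTranspose_mul]; simp only [Matrix.mul_assoc],
    Matrix.mul_apply, Complex.ofReal_mul, Complex.ofReal_ofNat, Complex.ofReal_sum]
  congr 1
  refine Finset.sum_congr rfl fun i _ => ?_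
  rw [Matrix.conjTranspose_apply, Complex.star_def, Complex.conj_mul', Complex.ofReal_pow]

/-- `(x + y)² ≤ 2·(x² + y²)`: the ℓ¹–ℓ² comparison on `Fin 2`. [folklore] -/
theorem sq_sum_two_le (v : Fin 2 → ℂ) : (∑ i, ‖v i‖) ^ 2 ≤ 2 * ∑ i, ‖v i‖ ^ 2 := by
  simp only [Fin.sum_univ_two]
  nlinarith [sq_nonneg (‖v 0‖ - ‖v 1‖)]

/-- **THE VELOCITY OF THE WEIGHT COORDINATE, UNIFORMLY IN THE DATUM**: along `g·exp(τX)` (`g ∈ U(J)` with entries `≤ R`, `X ∈ 𝔲(J)` with entries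
`≤ RX`) the coordinate `P(τ) = Re (aᴴ(2V(τ))a)₀₀` has a derivative `P′` at `τ = 0` with **`|P′| ≤ 256·R²·RX·P(0)`** for EVERY `a`
(`P = 2‖v‖²`, `v = d⁻¹(ae₀)`, `v′ = −d⁻¹d′v`, `P′ = 4·Re⟨v, v′⟩`). [Shimura1997, §6.3, §16.4] [Knapp1986, Ch. VIII §3] -/
theorem exists_hasDerivAt_weightP_ray {g X : Matrix (Fin 2 ⊕ Fin 2) (Fin 2 ⊕ Fin 2) ℂ} (hg : gᴴ * Matrix.J (Fin 2) ℂ * g = Matrix.J (Fin 2) ℂ)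
    (hX : Xᴴ * Matrix.J (Fin 2) ℂ + Matrix.J (Fin 2) ℂ * X = 0) {R RX : ℝ} (hR : ∀ i j, ‖g i j‖ ≤ R) (hRX : ∀ i j, ‖X i j‖ ≤ RX)
    (a : Matrix (Fin 2) (Fin 2) ℂ) :
    ∃ P' : ℝ, HasDerivAt (fun τ : ℝ => ((aᴴ * ((2 : ℂ) • ((2 * I)⁻¹ • (moeb (g * NormedSpace.exp (τ • X)) (I • (1 : Matrix (Fin 2) (Fin 2) ℂ)) -
        (moeb (g * NormedSpace.exp (τ • X)) (I • (1 : Matrix (Fin 2) (Fin 2) ℂ)))ᴴ))) * a) 0 0).re) P' 0 ∧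
      |P'| ≤ 256 * R ^ 2 * RX *
        ((aᴴ * ((2 : ℂ) • ((2 * I)⁻¹ • (moeb g (I • (1 : Matrix (Fin 2) (Fin 2) ℂ)) - (moeb g (I • (1 : Matrix (Fin 2) (Fin 2) ℂ)))ᴴ))) * a) 0 0).re := by
  set Δ : Matrix (Fin 2) (Fin 2) ℂ := denom g (I • (1 : Matrix (Fin 2) (Fin 2) ℂ)) with hΔ
  set d' : Matrix (Fin 2) (Fin 2) ℂ := denom (g * X) (I • (1 : Matrix (Fin 2) (Fin 2) ℂ)) with hd'
  set d : ℝ → Matrix (Fin 2) (Fin 2) ℂ := fun τ => denom (g * NormedSpace.exp (τ • X)) (I • (1 : Matrix (Fin 2) (Fin 2) ℂ)) with hddef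
  have hd0 : d 0 = Δ := by simp only [hddef, zero_smul, NormedSpace.exp_zero, Matrix.mul_one, hΔ]
  have hΔu : IsUnit Δ.det := isUnit_det_denom hg posDef_im_I_smul_one
  have hR0 : 0 ≤ R := (norm_nonneg _).trans (hR (Sum.inl 0) (Sum.inl 0))
  have hv : ∀ i : Fin 2, HasDerivAt (fun τ : ℝ => ((d τ)⁻¹ * a) i 0) ((-(Δ⁻¹ * d' * Δ⁻¹) * a) i 0) 0 := fun i => by
    rw [show (fun τ : ℝ => ((d τ)⁻¹ * a) i 0) = fun τ => ∑ k, (d τ)⁻¹ i k * a k 0 from funext fun τ => Matrix.mul_apply, Matrix.mul_apply]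
    exact HasDerivAt.fun_sum fun k _ => (hasDerivAt_inv_denom_entry_ray hg hX i k).mul_const (a k 0)
  have hP : (fun τ : ℝ => ((aᴴ * ((2 : ℂ) • ((2 * I)⁻¹ • (moeb (g * NormedSpace.exp (τ • X)) (I • (1 : Matrix (Fin 2) (Fin 2) ℂ)) -
      (moeb (g * NormedSpace.exp (τ • X)) (I • (1 : Matrix (Fin 2) (Fin 2) ℂ)))ᴴ))) * a) 0 0).re) = fun τ => 2 * ∑ i, ‖((d τ)⁻¹ * a) i 0‖ ^ 2 := by
    funext τ
    rw [weight_apply_zero_zero_eq (mul_mem_UJ hg (conjTranspose_exp_mul_J_mul_exp hX τ)) a, Complex.ofReal_re]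
  have hP0 : ((aᴴ * ((2 : ℂ) • ((2 * I)⁻¹ • (moeb g (I • (1 : Matrix (Fin 2) (Fin 2) ℂ)) - (moeb g (I • (1 : Matrix (Fin 2) (Fin 2) ℂ)))ᴴ))) * a) 0 0).re =
      2 * ∑ i, ‖(Δ⁻¹ * a) i 0‖ ^ 2 := by
    rw [weight_apply_zero_zero_eq hg a, Complex.ofReal_re]
  have hderiv : HasDerivAt (fun τ : ℝ => 2 * ∑ i, ‖((d τ)⁻¹ * a) i 0‖ ^ 2)
      (2 * ∑ i, 2 * inner ℝ ((Δ⁻¹ * a) i 0) ((-(Δ⁻¹ * d' * Δ⁻¹) * a) i 0)) 0 := by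
    refine HasDerivAt.const_mul 2 (HasDerivAt.fun_sum fun i _ => ?_)
    have h := (hv i).norm_sq
    beta_reduce at h
    rw [hd0] at h
    exact h
  refine ⟨_, by rw [hP]; exact hderiv, ?_⟩
  have hinv : ∀ i j, ‖Δ⁻¹ i j‖ ≤ 4 * R := fun i j => by
    have h := norm_inv_denom_I_apply_le hg hR i j
    simp only [Fintype.card_fin, Nat.cast_ofNat] at h
    linarith
  have hdd : ∀ i j, ‖d' i j‖ ≤ 2 * (4 * R * RX) := norm_denom_I_apply_le (norm_mul_X_apply_le hR hRX)
  have hK : ∀ i j, ‖(Δ⁻¹ * d') i j‖ ≤ 64 * R ^ 2 * RX := fun i j => by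
    have h := norm_mul_apply_le (by positivity) hinv hdd i j
    simp only [Fintype.card_fin, Nat.cast_ofNat] at h
    linarith
  set v : Fin 2 → ℂ := fun k => (Δ⁻¹ * a) k 0 with hvdef
  have hw : ∀ i, ‖((-(Δ⁻¹ * d' * Δ⁻¹)) * a) i 0‖ ≤ 64 * R ^ 2 * RX * ∑ k, ‖v k‖ := fun i => by
    rw [Matrix.neg_mul, Matrix.neg_apply, norm_neg, Matrix.mul_assoc (Δ⁻¹ * d') Δ⁻¹ a]
    exact norm_mulVec_apply_le hK v i
  have hS : (∑ k, ‖v k‖) ^ 2 ≤ 2 * ∑ k, ‖v k‖ ^ 2 := sq_sum_two_le v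
  have hRX0 : 0 ≤ RX := (norm_nonneg _).trans (hRX (Sum.inl 0) (Sum.inl 0))
  have hterm : ∀ i, |2 * inner ℝ ((Δ⁻¹ * a) i 0) ((-(Δ⁻¹ * d' * Δ⁻¹) * a) i 0)| ≤ 2 * (‖v i‖ * (64 * R ^ 2 * RX * ∑ k, ‖v k‖)) := fun i => by
    rw [abs_mul, abs_two]
    refine mul_le_mul_of_nonneg_left ((abs_real_inner_le_norm _ _).trans ?_) zero_le_two
    exact mul_le_mul_of_nonneg_left (hw i) (norm_nonneg _)
  rw [hP0]
  calc |2 * ∑ i, 2 * inner ℝ ((Δ⁻¹ * a) i 0) ((-(Δ⁻¹ * d' * Δ⁻¹) * a) i 0)|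
      = 2 * |∑ i, 2 * inner ℝ ((Δ⁻¹ * a) i 0) ((-(Δ⁻¹ * d' * Δ⁻¹) * a) i 0)| := by rw [abs_mul, abs_two]
    _ ≤ 2 * ∑ i, |2 * inner ℝ ((Δ⁻¹ * a) i 0) ((-(Δ⁻¹ * d' * Δ⁻¹) * a) i 0)| := by gcongr; exact Finset.abs_sum_le_sum_abs _ _
    _ ≤ 2 * ∑ i, 2 * (‖v i‖ * (64 * R ^ 2 * RX * ∑ k, ‖v k‖)) := by gcongr with i; exact hterm i
    _ = 4 * (64 * R ^ 2 * RX) * (∑ k, ‖v k‖) ^ 2 := by rw [← Finset.mul_sum, ← Finset.sum_mul]; ring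
    _ ≤ 4 * (64 * R ^ 2 * RX) * (2 * ∑ k, ‖v k‖ ^ 2) := by gcongr
    _ = 256 * R ^ 2 * RX * (2 * ∑ i, ‖(Δ⁻¹ * a) i 0‖ ^ 2) := by rw [hvdef]; ring

/-! ## §4 The phase `u = tr(T·Re(h·i1))`, `T = a·diag(t,0)·aᴴ`: rank-one trace formula and velocity, uniformly in `a` -/

/-- **`tr((a·diag(t,0)·aᴴ)·N) = t·(ae₀)ᴴ·N·(ae₀)`**. [folklore] -/
theorem trace_rankOne_mul (a : Matrix (Fin 2) (Fin 2) ℂ) (t : ℝ) (N : Matrix (Fin 2) (Fin 2) ℂ) :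
    ((a * hermTwo (t, 0, 0) * aᴴ) * N).trace = (t : ℂ) * (star (fun i => a i 0) ⬝ᵥ (N *ᵥ fun i => a i 0)) := by
  simp only [Matrix.trace_fin_two, Matrix.mul_apply, Fin.sum_univ_two, hermTwo_apply_zero_zero, hermTwo_apply_zero_one,
    hermTwo_apply_one_zero, hermTwo_apply_one_one, Matrix.conjTranspose_apply, dotProduct, Matrix.mulVec, Pi.star_apply,
    map_zero, Complex.ofReal_zero, mul_zero, zero_mul, add_zero]
  ring

/-- `cᴴ·Nᴴ·c = star(cᴴ·N·c)`. [folklore] -/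
theorem star_dotProduct_conjTranspose_mulVec (N : Matrix (Fin 2) (Fin 2) ℂ) (c : Fin 2 → ℂ) :
    star c ⬝ᵥ (Nᴴ *ᵥ c) = star (star c ⬝ᵥ (N *ᵥ c)) := by
  rw [← Matrix.star_dotProduct_star, Matrix.star_mulVec, star_star, ← dotProduct_mulVec]

/-- `‖2⁻¹·(z + star z)‖ ≤ ‖z‖`. [folklore] -/
theorem norm_half_add_star_le (z : ℂ) : ‖(2 : ℂ)⁻¹ * (z + star z)‖ ≤ ‖z‖ := by
  rw [norm_mul, norm_inv, Complex.norm_ofNat]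
  have h : ‖z + star z‖ ≤ ‖z‖ + ‖z‖ := (norm_add_le _ _).trans (by rw [norm_star])
  linarith

/-- **THE VELOCITY OF THE PHASE, UNIFORMLY IN THE DATUM**: along `g·exp(τX)` (`g ∈ U(J)` with entries `≤ R`, `X ∈ 𝔲(J)` with entries `≤ RX`),
`u(τ) = tr((a·diag(t,0)·aᴴ)·Re(moeb(g·exp(τX))·i1))` has a derivative `u′` at `τ = 0` with **`‖u′‖ ≤ 1056·(1+R)⁴·RX·(t·P(0))`** for EVERY
`a` and `t ≥ 0` (`(ae₀)ᴴ·moeb′·(ae₀) = vᴴ·dᴴ(num(gX,i1) − moeb·d′)·v`, `P = 2‖v‖²`). [Shimura1997, §6.3, §16.4] [Knapp1986, Ch. VIII §3] -/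
theorem exists_hasDerivAt_traceU_ray {g X : Matrix (Fin 2 ⊕ Fin 2) (Fin 2 ⊕ Fin 2) ℂ} (hg : gᴴ * Matrix.J (Fin 2) ℂ * g = Matrix.J (Fin 2) ℂ)
    (hX : Xᴴ * Matrix.J (Fin 2) ℂ + Matrix.J (Fin 2) ℂ * X = 0) {R RX : ℝ} (hR : ∀ i j, ‖g i j‖ ≤ R) (hRX : ∀ i j, ‖X i j‖ ≤ RX)
    (a : Matrix (Fin 2) (Fin 2) ℂ) {t : ℝ} (ht : 0 ≤ t) :
    ∃ u' : ℂ, HasDerivAt (fun τ : ℝ => ((a * hermTwo (t, 0, 0) * aᴴ) * ((2 : ℂ)⁻¹ • (moeb (g * NormedSpace.exp (τ • X)) (I • (1 : Matrix (Fin 2) (Fin 2) ℂ)) +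
        (moeb (g * NormedSpace.exp (τ • X)) (I • (1 : Matrix (Fin 2) (Fin 2) ℂ)))ᴴ))).trace) u' 0 ∧
      ‖u'‖ ≤ 1056 * (1 + R) ^ 4 * RX *
        (t * ((aᴴ * ((2 : ℂ) • ((2 * I)⁻¹ • (moeb g (I • (1 : Matrix (Fin 2) (Fin 2) ℂ)) - (moeb g (I • (1 : Matrix (Fin 2) (Fin 2) ℂ)))ᴴ))) * a) 0 0).re) := by
  set Δ : Matrix (Fin 2) (Fin 2) ℂ := denom g (I • (1 : Matrix (Fin 2) (Fin 2) ℂ)) with hΔ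
  set d' : Matrix (Fin 2) (Fin 2) ℂ := denom (g * X) (I • (1 : Matrix (Fin 2) (Fin 2) ℂ)) with hd'
  set n' : Matrix (Fin 2) (Fin 2) ℂ := num (g * X) (I • (1 : Matrix (Fin 2) (Fin 2) ℂ)) with hn'
  set M₀ : Matrix (Fin 2) (Fin 2) ℂ := moeb g (I • (1 : Matrix (Fin 2) (Fin 2) ℂ)) with hM₀
  set M' : Matrix (Fin 2) (Fin 2) ℂ := (n' - M₀ * d') * Δ⁻¹ with hM'
  set c : Fin 2 → ℂ := fun i => a i 0 with hc
  have hΔu : IsUnit Δ.det := isUnit_det_denom hg posDef_im_I_smul_one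
  have hR0 : 0 ≤ R := (norm_nonneg _).trans (hR (Sum.inl 0) (Sum.inl 0))
  have hRX0 : 0 ≤ RX := (norm_nonneg _).trans (hRX (Sum.inl 0) (Sum.inl 0))
  have hm : HasDerivAt (fun τ : ℝ => star c ⬝ᵥ (moeb (g * NormedSpace.exp (τ • X)) (I • (1 : Matrix (Fin 2) (Fin 2) ℂ)) *ᵥ c)) (star c ⬝ᵥ (M' *ᵥ c)) 0 := by
    simp only [dotProduct, Matrix.mulVec, Pi.star_apply]
    exact HasDerivAt.fun_sum fun j _ => (HasDerivAt.fun_sum fun i _ => (hasDerivAt_moeb_entry_ray hg hX j i).mul_const (c i)).const_mul (star (c j))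
  have hu : (fun τ : ℝ => ((a * hermTwo (t, 0, 0) * aᴴ) * ((2 : ℂ)⁻¹ • (moeb (g * NormedSpace.exp (τ • X)) (I • (1 : Matrix (Fin 2) (Fin 2) ℂ)) +
      (moeb (g * NormedSpace.exp (τ • X)) (I • (1 : Matrix (Fin 2) (Fin 2) ℂ)))ᴴ))).trace) =
      fun τ => (t : ℂ) * ((2 : ℂ)⁻¹ * (star c ⬝ᵥ (moeb (g * NormedSpace.exp (τ • X)) (I • (1 : Matrix (Fin 2) (Fin 2) ℂ)) *ᵥ c) +
        star (star c ⬝ᵥ (moeb (g * NormedSpace.exp (τ • X)) (I • (1 : Matrix (Fin 2) (Fin 2) ℂ)) *ᵥ c)))) := by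
    funext τ
    rw [trace_rankOne_mul, Matrix.smul_mulVec, dotProduct_smul, Matrix.add_mulVec, dotProduct_add, star_dotProduct_conjTranspose_mulVec,
      smul_eq_mul]
  have hderiv : HasDerivAt (fun τ : ℝ => (t : ℂ) * ((2 : ℂ)⁻¹ * (star c ⬝ᵥ (moeb (g * NormedSpace.exp (τ • X)) (I • (1 : Matrix (Fin 2) (Fin 2) ℂ)) *ᵥ c) +
        star (star c ⬝ᵥ (moeb (g * NormedSpace.exp (τ • X)) (I • (1 : Matrix (Fin 2) (Fin 2) ℂ)) *ᵥ c)))))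
      ((t : ℂ) * ((2 : ℂ)⁻¹ * (star c ⬝ᵥ (M' *ᵥ c) + star (star c ⬝ᵥ (M' *ᵥ c))))) 0 :=
    ((hm.add hm.star).const_mul _).const_mul _
  refine ⟨_, by rw [hu]; exact hderiv, ?_⟩
  set v : Fin 2 → ℂ := Δ⁻¹ *ᵥ c with hvdef
  have hv_def : v = fun k => (Δ⁻¹ * a) k 0 := by rw [hvdef]; rfl
  have hcv : c = Δ *ᵥ v := by rw [hvdef, Matrix.mulVec_mulVec, Matrix.mul_nonsing_inv _ hΔu, Matrix.one_mulVec]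
  have hm' : star c ⬝ᵥ (M' *ᵥ c) = star v ⬝ᵥ ((Δᴴ * (n' - M₀ * d')) *ᵥ v) := by
    rw [hM', ← Matrix.mulVec_mulVec, ← hvdef, hcv, Matrix.star_mulVec, ← dotProduct_mulVec, Matrix.mulVec_mulVec]
  have hΔe : ∀ i j, ‖Δᴴ i j‖ ≤ 2 * R := fun i j => by rw [Matrix.conjTranspose_apply, norm_star]; exact norm_denom_I_apply_le hR j i
  have hinv : ∀ i j, ‖Δ⁻¹ i j‖ ≤ 4 * R := fun i j => by
    have h := norm_inv_denom_I_apply_le hg hR i j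
    simp only [Fintype.card_fin, Nat.cast_ofNat] at h
    linarith
  have hnum : ∀ i j, ‖num g (I • (1 : Matrix (Fin 2) (Fin 2) ℂ)) i j‖ ≤ 2 * R := norm_num_I_apply_le hR
  have hM₀e : ∀ i j, ‖M₀ i j‖ ≤ 16 * R ^ 2 := fun i j => by
    have h := norm_mul_apply_le (by positivity) hnum hinv i j
    rw [hM₀, moeb_def]
    simp only [Fintype.card_fin, Nat.cast_ofNat] at h
    linarith
  have hdd : ∀ i j, ‖d' i j‖ ≤ 2 * (4 * R * RX) := norm_denom_I_apply_le (norm_mul_X_apply_le hR hRX)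
  have hnn : ∀ i j, ‖n' i j‖ ≤ 2 * (4 * R * RX) := norm_num_I_apply_le (norm_mul_X_apply_le hR hRX)
  have hMd : ∀ i j, ‖(M₀ * d') i j‖ ≤ 256 * R ^ 3 * RX := fun i j => by
    have h := norm_mul_apply_le (by positivity) hM₀e hdd i j
    simp only [Fintype.card_fin, Nat.cast_ofNat] at h
    linarith
  have hdiff : ∀ i j, ‖(n' - M₀ * d') i j‖ ≤ 8 * R * RX + 256 * R ^ 3 * RX := fun i j => by
    rw [Matrix.sub_apply]
    exact (norm_sub_le _ _).trans (add_le_add (by linarith [hnn i j]) (hMd i j))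
  have hK : ∀ i j, ‖(Δᴴ * (n' - M₀ * d')) i j‖ ≤ 1056 * (1 + R) ^ 4 * RX := fun i j => by
    have h := norm_mul_apply_le (by positivity) hΔe hdiff i j
    simp only [Fintype.card_fin, Nat.cast_ofNat] at h
    have h2 : R ^ 2 ≤ (1 + R) ^ 4 := by nlinarith [sq_nonneg R, sq_nonneg (1 + R), mul_nonneg hR0 (sq_nonneg R)]
    have h4 : R ^ 4 ≤ (1 + R) ^ 4 := pow_le_pow_left₀ hR0 (by linarith) 4
    nlinarith [mul_le_mul_of_nonneg_right h2 hRX0, mul_le_mul_of_nonneg_right h4 hRX0]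
  have hw : ∀ j, ‖((Δᴴ * (n' - M₀ * d')) *ᵥ v) j‖ ≤ 1056 * (1 + R) ^ 4 * RX * ∑ k, ‖v k‖ := norm_mulVec_apply_le hK v
  have hS : (∑ k, ‖v k‖) ^ 2 ≤ 2 * ∑ k, ‖v k‖ ^ 2 := sq_sum_two_le v
  have hP0 : ((aᴴ * ((2 : ℂ) • ((2 * I)⁻¹ • (moeb g (I • (1 : Matrix (Fin 2) (Fin 2) ℂ)) - (moeb g (I • (1 : Matrix (Fin 2) (Fin 2) ℂ)))ᴴ))) * a) 0 0).re =
      2 * ∑ k, ‖v k‖ ^ 2 := by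
    rw [weight_apply_zero_zero_eq hg a, Complex.ofReal_re, hv_def, hΔ]
  have hmb : ‖star c ⬝ᵥ (M' *ᵥ c)‖ ≤ 1056 * (1 + R) ^ 4 * RX * (2 * ∑ k, ‖v k‖ ^ 2) := by
    rw [hm']
    calc ‖star v ⬝ᵥ ((Δᴴ * (n' - M₀ * d')) *ᵥ v)‖ ≤ ∑ j, ‖v j‖ * ‖((Δᴴ * (n' - M₀ * d')) *ᵥ v) j‖ := norm_star_dotProduct_le _ _
      _ ≤ ∑ j, ‖v j‖ * (1056 * (1 + R) ^ 4 * RX * ∑ k, ‖v k‖) := Finset.sum_le_sum fun j _ => mul_le_mul_of_nonneg_left (hw j) (norm_nonneg _)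
      _ = 1056 * (1 + R) ^ 4 * RX * (∑ k, ‖v k‖) ^ 2 := by rw [← Finset.sum_mul]; ring
      _ ≤ 1056 * (1 + R) ^ 4 * RX * (2 * ∑ k, ‖v k‖ ^ 2) := by gcongr
  rw [hP0, norm_mul, Complex.norm_real, Real.norm_of_nonneg ht]
  calc t * ‖(2 : ℂ)⁻¹ * (star c ⬝ᵥ (M' *ᵥ c) + star (star c ⬝ᵥ (M' *ᵥ c)))‖ ≤ t * ‖star c ⬝ᵥ (M' *ᵥ c)‖ :=
        mul_le_mul_of_nonneg_left (norm_half_add_star_le _) ht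
    _ ≤ t * (1056 * (1 + R) ^ 4 * RX * (2 * ∑ k, ‖v k‖ ^ 2)) := mul_le_mul_of_nonneg_left hmb ht
    _ = 1056 * (1 + R) ^ 4 * RX * (t * (2 * ∑ k, ‖v k‖ ^ 2)) := by ring

end Summit.HodgeConjecture.HodgeConjecture.Cruxes.HLiu418.K2LiuArchTwistedRayAtomBounds

end
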